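import Summits.KontsevichZagierPeriods.Zeta5Search.LaiSweepShard

/-!
# `κ₃` sweep certificate — shard file 099 of 127 (shards 693–699 of 889)

HONEST FRAMING. Systematic search; no irrationality claim unless certified. This file only checks,
by `decide +kernel`, shards 693–699 of the order-cell sweep of the `κ₃` point `(74, 2180, 444; δ74)`
(engine `LaiSweepEngine`, soundness `LaiSweepJump/Free/Eval/Shard/Kappa3`; a shard is `⟨regime, n,
p, q, p', q', Lo, Up⟩`: `n` cells from `p/q` to `p'/q'` with integer rate sums in `[Lo, Up]`, `K =
128`, `D = 2^40`). It draws NO conclusion: only the capstone `LaiKappa3SweepCert`, which needs all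
127 shard files, does. Kernel cost of this file ≈ 560 cells × 0.3 s.
-/

namespace Summit.KontsevichZagierPeriods.Zeta5Search.Sweep

set_option maxHeartbeats 100000000 in
/-- Shard 693: 80 cells of regime B from `193/256` to `330/437`.
[cite: Lai2024BallRivoal, §4 Lemma 4.3] -/
theorem shard693 :
    Shard.check 128 (2^40)
      ⟨true, 80, 193, 256, 330, 437, 11386895037458, 17040200556421⟩ = true := by
  decide +kernel

set_option maxHeartbeats 100000000 in
/-- Shard 694: 80 cells of regime B from `330/437` to `208/275`.
[cite: Lai2024BallRivoal, §4 Lemma 4.3] -/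
theorem shard694 :
    Shard.check 128 (2^40)
      ⟨true, 80, 330, 437, 208, 275, 11122393583500, 16661534410078⟩ = true := by
  decide +kernel

set_option maxHeartbeats 100000000 in
/-- Shard 695: 80 cells of regime B from `208/275` to `247/326`.
[cite: Lai2024BallRivoal, §4 Lemma 4.3] -/
theorem shard695 :
    Shard.check 128 (2^40)
      ⟨true, 80, 208, 275, 247, 326, 11932994514695, 17894754467959⟩ = true := by
  decide +kernel

set_option maxHeartbeats 100000000 in
/-- Shard 696: 80 cells of regime B from `247/326` to `192/253`.
[cite: Lai2024BallRivoal, §4 Lemma 4.3] -/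
theorem shard696 :
    Shard.check 128 (2^40)
      ⟨true, 80, 247, 326, 192, 253, 11192131382587, 16801517794167⟩ = true := by
  decide +kernel

set_option maxHeartbeats 100000000 in
/-- Shard 697: 80 cells of regime B from `192/253` to `317/417`.
[cite: Lai2024BallRivoal, §4 Lemma 4.3] -/
theorem shard697 :
    Shard.check 128 (2^40)
      ⟨true, 80, 192, 253, 317, 417, 11855358217856, 17816002805644⟩ = true := by
  decide +kernel

set_option maxHeartbeats 100000000 in
/-- Shard 698: 80 cells of regime B from `317/417` to `217/285`.
[cite: Lai2024BallRivoal, §4 Lemma 4.3] -/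
theorem shard698 :
    Shard.check 128 (2^40)
      ⟨true, 80, 317, 417, 217, 285, 11045569303996, 16616452225060⟩ = true := by
  decide +kernel

set_option maxHeartbeats 100000000 in
/-- Shard 699: 80 cells of regime B from `217/285` to `286/375`.
[cite: Lai2024BallRivoal, §4 Lemma 4.3] -/
theorem shard699 :
    Shard.check 128 (2^40)
      ⟨true, 80, 217, 285, 286, 375, 11508447151660, 17330813782559⟩ = true := by
  decide +kernel

/-- The checked shards of this file, in order. [folklore] -/
def shards099 : List (CheckedShard 128 (2^40)) :=
  [⟨_, shard693⟩, ⟨_, shard694⟩, ⟨_, shard695⟩, ⟨_, shard696⟩, ⟨_, shard697⟩,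
    ⟨_, shard698⟩, ⟨_, shard699⟩]

end Summit.KontsevichZagierPeriods.Zeta5Search.Sweep
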